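import Summits.QuantumFields.YangMills.Theorems.BalabanUVNodesProp4V0AtRecord
import Summits.QuantumFields.YangMills.Theorems.BalabanUVNodesN07SectCRegimeOfRecordSmall
import Summits.QuantumFields.YangMills.Theorems.BalabanUVNodesN07ChartLineFactsS1
import Literature.MathematicalPhysics.QuantumFieldTheory.Balaban1983to89.B11Ineq73KernelLettersPerLattice
import Literature.MathematicalPhysics.QuantumFieldTheory.Balaban1983to89.B9Ineq369CurvatureSmall
import HarnessLib

/-!
# NODE N07 — (R2) «PROP. 4 FOR `W`» AT THE RECORD, PER LATTICE AND IN THE SMALL: `∃ t₀ > 0, ∀ 0 < ε_C ≤ t₀, ∃ a₃ > 0, ∃ C₄ ≥ 0, QuadAnalytic (WOfRecordAt … U₀ … ε_C G′) C₄ a₃`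
# — ANY `N`, ANY guarded background `U₀`, ANY `G′` (existential, NON-uniform constants)

Cell `pub-ymgap`, width seat `pub-ymgap-dag-n07-w3` (g27), INTENT-18 ∕ CLAIM-18.  `--kind proof --supports stmt-QuantumFields-27238 --as helper`; count-neutral.
[15] = [Balaban1985Variational]; [B9] = [Balaban1985BackgroundPropagators]; [B7] = [Balaban1985Averaging].

WHY.  def-Y's `RegimeTok` row (R2) `quad : QuadAnalytic (S.W V) S.C₄ S.a₃` — [15] Prop. 4 (98) for the record's `W := WOfRecordAt F N K k Ω U₀ levB a hpos♭ hQ ε_C G′` (lit ✓`B11Eq80Current.W80` at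
the record's letters, `Node00.BgRemainderOfRecord` :506) — is the ONE analytic input my flat (R-a) road (✓p826658 ∕ ✓p826780 ∕ ✓p827017) still displays.  Print proves it with constants
«depending on d and L only»; the tree holds every brick of the PER-LATTICE statement: lit ✓`B11Ineq73KernelLettersPerLattice.exists_quadAnalytic_W80` (the kernel-column letters `θ_E`,
`θ₃` inhabited at a fixed lattice) wants (a) the Sect. C regime `Regime H♭ 0 C^{𝔰𝔩} b 0 C₂ c₄ 0 a_C ε_C` with `Prop4Hyp C^{𝔰𝔩} C₂ c₄` — my ✓`exists_sectCRegime_ofRecord` (p826188, in the small,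
any `N`, any guarded `U₀`) — and (b) the V₀-group's slot `hqV : ‖Y‖ < R_V → ‖curV0 ρ τ U₀ Y‖ ≤ C_V‖Y‖²` — porter PTB-1's ✓`Prop4V0AtRecord.curV0AtRecord_quadBound` (the `(c·ρ, c⁻¹·τ)`
rescaling of lit's V₀ bound for the record's NON-contractive `τ = tr`), whose displayed letters `α` (plaquette window) and `ω`, `Ω` (weight profile) are INHABITED PER LATTICE here
(`α := 2∕η²` since `‖U₀(∂p)‖ ≤ 1`, lit ✓`B9Ineq369CurvatureSmall.norm_plaqHolU_le` + ✓`unitsOfRecord_mem_U1`; `ω`, `Ω` := the finite sups themselves).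

WHAT IS PROVED (kernel-checked, sorry-free, standard axioms only).
* §1 `quadAnalytic_of_radius_le` (bookkeeping: (98) on a ball holds on every smaller ball); ★★ `curV0AtRecord_quadBound_perLattice` — `∃ C_V ≥ 0, ∀ ‖Y‖ < 1∕16, ‖curV0 (rhoRec N) (tauRecCLM N)
  (unitsOfRecord F N U₀) Y‖ ≤ C_V‖Y‖²` at EVERY background, NO letter (any `N ≥ 1`).
* §2 ★★★ `exists_quadAnalytic_WOfRecordAt` — under the guard `SmallBelow (avOfRecord F N K) k U₀` ONLY: `∃ t₀ > 0, ∀ ε_C, 0 < ε_C → ε_C ≤ t₀ → ∃ a₃ > 0, ∃ C₄ ≥ 0, a₃ ≤ ε_C ∧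
  QuadAnalytic (WOfRecordAt F N K k Ω U₀ levB a hpos♭ hQ ε_C G′) C₄ a₃` (any `N`, `U₀`, `G′`, `levB`, `a`, binders); ★★★ `exists_quadAnalytic_WOfRecordAt_one` — the same at `U₀ = 1`
  with no guard (✓`smallBelow_one`).

HONEST LABELS.  PER-LATTICE, IN-THE-SMALL, EXISTENTIAL: `t₀`, `a₃`, `C₄` depend on the lattice (`K`, `k`, `η`, the level maps), on the background and on the binders — NOT print's «d and L
only» (that uniformity is [15] Prop. 4 proper and stays the N06 ∕ lit lane's business: ✓`BalabanUVNodesProp4UniformAtRecord` displays its [B9]-class inputs).  Nothing of [15] is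
re-derived: this file FEEDS landed theorems.  Count-neutral; N07 NOT discharged; K0ᴬ ⟨27238⟩ NOT closed; R4 is the conditional finite-𝕋⁴ rung `BalabanLadder.UV` only; finite torus,
fixed `ε` — nothing continuum ∕ OS ∕ Clay.  **The Yang–Mills mass gap is NOT proved by any of this.**  No `sorry`, no `instance ∕ notation`; standard axioms.
-/

set_option autoImplicit false

noncomputable section

open scoped BigOperators Matrix.Norms.L2Operator InnerProductSpace NNReal

namespace Summit.QuantumFields.YangMills.Theorems.N07Prop4WOfRecordPerLattice

open Literature.MathematicalPhysics.QuantumFieldTheory.Balaban1983to89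
open Literature.MathematicalPhysics.QuantumFieldTheory.Balaban1983to89.T4Continuum (T4Family)
open T4Continuum BlockAveraging
open B7Prop1Explicit (U1)
open B9Eq310DeltaPrime (plaqHolU)
open B11Eq103H1Complex (SiteL2K BondL2K)
open B11Eq111FrakG (nabla115)
open B11Eq115Space (NegSize NegSup levWeight JetSup Space115)
open B11Eq174Chart (Regime)
open B11Prop6Scheme (Prop4Hyp)
open B13Contraction113 (QuadAnalytic)
open B11Eq63V0GroupCurrent (curV0)
open B11Ineq73KernelLettersPerLattice (exists_quadAnalytic_W80)
open B9Ineq369CurvatureSmall (norm_plaqHolU_le)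
open Node00
open Summit.QuantumFields.YangMills.Theorems.Prop4V0AtRecord (curV0AtRecord_quadBound unitsOfRecord_mem_U1)
open Summit.QuantumFields.YangMills.Theorems.N07SectCRegimeOfRecordSmall (exists_sectCRegime_ofRecord)

/-! ## §1  Bookkeeping on (98), and the V₀-group's slot per lattice at every background -/

/-- Bookkeeping: Prop. 4's shape `QuadAnalytic W C R` persists on every smaller ball `R′ ≤ R`. [cite: Balaban1985Variational, Prop. 4 (98) p.293 (bookkeeping)] -/
theorem quadAnalytic_of_radius_le {𝒴 𝒵 : Type*} [NormedAddCommGroup 𝒴] [NormedSpace ℂ 𝒴] [NormedAddCommGroup 𝒵] [NormedSpace ℂ 𝒵]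
    {W : 𝒴 → 𝒵} {C R R' : ℝ} (h : QuadAnalytic W C R) (hR : R' ≤ R) : QuadAnalytic W C R' where
  quad Y hY := h.quad Y (lt_of_lt_of_le hY hR)
  lineAnalytic P Q := (h.lineAnalytic P Q).mono fun _ hζ => lt_of_lt_of_le hζ hR

section Record

variable (F : T4Family) (N : ℕ) [NeZero N] (K : ℕ) (k : ℕ) (Ω : ℕ → Set (Site (F.P K) 0)) (U₀ : GaugeField (F.P K) 0 (SU N))
  [Fact (0 < (F.L : ℝ))] [Fact (0 < (F.P K).eta k)]

/-- ★★ **THE V₀-GROUP's (98)-SLOT AT THE RECORD, PER LATTICE, AT EVERY BACKGROUND, NO LETTER**: `∃ C_V ≥ 0, ‖Y‖ < 1∕16 → ‖curV0 (rhoRec N) (tauRecCLM N) (unitsOfRecord F N U₀) Y‖ ≤ C_V‖Y‖²`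
— porter ✓`curV0AtRecord_quadBound` with its plaquette window `α := 2∕η²` (`‖U₀(∂p) − 1‖ ≤ ‖U₀(∂p)‖ + 1 ≤ 2`, `SU(N)`-unitary bond variables) and its weight-profile letters taken to be the
finite sups `w̄`, `w̲⁻¹` of THIS lattice's level weights. [cite: Balaban1985Variational, (98) p.293, (90)–(96) pp.291–292; Balaban1985BackgroundPropagators, (3.1) p.390; Balaban1985Averaging, (19)–(20) p.21] -/
theorem curV0AtRecord_quadBound_perLattice :
    ∃ CV : ℝ, 0 ≤ CV ∧ ∀ Y : Space115Lit F N K k Ω U₀, ‖Y‖ < 1 / 16 →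
      ‖curV0 (lev₁ := pairLevLit F Ω k) (Dc := nabla115 ((F.P K).eta k) (unitsOfRecord F N U₀)) (rhoRec N) (tauRecCLM N) (unitsOfRecord F N U₀) Y‖ ≤
        CV * ‖Y‖ ^ 2 := by
  have hη : 0 < (F.P K).eta k := Fact.out
  -- the plaquette window, per lattice: `‖U₀(∂p) − 1‖ ≤ 2 = (2/η²)·η²`
  have hU1 : ∀ b, ‖(unitsOfRecord F N U₀ b : Matrix (Fin N) (Fin N) ℂ)‖ ≤ 1 ∧
      ‖(((unitsOfRecord F N U₀ b)⁻¹ : (Matrix (Fin N) (Fin N) ℂ)ˣ) : Matrix (Fin N) (Fin N) ℂ)‖ ≤ 1 := fun b => unitsOfRecord_mem_U1 F N U₀ b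
  have hpl : ∀ p : B9SectCLatticeCarrier.Plaq (F.P K).d (fun _ => (F.P K).sitesPerDir 0),
      ‖(plaqHolU (unitsOfRecord F N U₀) p : Matrix (Fin N) (Fin N) ℂ) - 1‖ ≤ 2 / (F.P K).eta k ^ 2 * (F.P K).eta k ^ 2 := fun p => by
    rw [div_mul_cancel₀ _ (pow_ne_zero 2 hη.ne')]
    calc ‖(plaqHolU (unitsOfRecord F N U₀) p : Matrix (Fin N) (Fin N) ℂ) - 1‖
        ≤ ‖(plaqHolU (unitsOfRecord F N U₀) p : Matrix (Fin N) (Fin N) ℂ)‖ + ‖(1 : Matrix (Fin N) (Fin N) ℂ)‖ := norm_sub_le _ _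
      _ ≤ 1 + 1 := add_le_add (norm_plaqHolU_le hU1 p).1 norm_one.le
      _ = 2 := by norm_num
  -- the weight profile, per lattice: the finite sups themselves
  set ω : ℝ := max 1 (NegSup.wSup (levWeight (F.L : ℝ) ((F.P K).eta k) (bondLevLit F Ω k) 1) : ℝ) with hω
  set Ωw : ℝ := max 1 (max (NegSup.wInvSup (levWeight (F.L : ℝ) ((F.P K).eta k) (bondLevLit F Ω k) 1) : ℝ)
    (NegSup.wInvSup (levWeight (F.L : ℝ) ((F.P K).eta k) (pairLevLit F Ω k) 2) : ℝ)) with hΩw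
  have hω1 : 1 ≤ ω := le_max_left _ _
  have hΩ1 : 1 ≤ Ωw := le_max_left _ _
  have hα : (0 : ℝ) ≤ 2 / (F.P K).eta k ^ 2 := by positivity
  refine ⟨_, ?_, fun Y hY => curV0AtRecord_quadBound F N k Ω U₀ hα hpl hω1 hΩ1 (le_max_right _ _)
    ((le_max_left _ _).trans (le_max_right _ _)) ((le_max_right _ _).trans (le_max_right _ _)) Y hY⟩
  have hω0 : 0 ≤ ω := zero_le_one.trans hω1
  have hΩ0 : 0 ≤ Ωw := zero_le_one.trans hΩ1
  positivity

end Record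

/-! ## §2  (R2) at the record, per lattice, in the small -/

section Prop4W

variable (F : T4Family) (N : ℕ) [NeZero N] (K : ℕ) (k : ℕ) (Ω : ℕ → Set (Site (F.P K) 0)) (U₀ : GaugeField (F.P K) 0 (SU N))
  [Fact (0 < (F.L : ℝ))] [Fact (0 < (F.P K).eta k)] [Fact (0 < c0Rec F K k)] [Fact (∀ c, 0 < wBRec F K k c)]
  (levB : PBond (F.P K) k → ℕ) (a : ℝ)
  (hposb : ∀ x, x ≠ 0 → 0 < RCLike.re ⟪x, laplaceAOfRecord F N k U₀ (QOfRecord F N k U₀) (QflatOfRecord F N k) a x⟫_ℂ)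
  (hQ : Function.Surjective (QOfRecord F N k U₀))
  (Gp : SiteL2K ℂ (F.P K).d (fun _ => (F.P K).sitesPerDir 0) (c0Rec F K k) (WRec N) →ₗ[ℂ]
    SiteL2K ℂ (F.P K).d (fun _ => (F.P K).sitesPerDir 0) (c0Rec F K k) (WRec N))

/-- ★★★ **(R2) — [15] PROP. 4 (98) FOR THE RECORD's `W`, PER LATTICE, IN THE SMALL, AT EVERY GUARDED BACKGROUND**: lit ✓`exists_quadAnalytic_W80` (kernel-column letters per lattice)
fed by ✓`exists_sectCRegime_ofRecord` (the Sect. C regime + `Prop4Hyp C^{𝔰𝔩}` for `0 < a_C ≤ ε_C ≤ t₀`, read at `a_C := ε_C`) and §1's V₀ slot; the radius is cut down to `a₃ ≤ ε_C`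
(`quadAnalytic_of_radius_le`) as def-Y's `RegimeTok.dom` wants. [cite: Balaban1985Variational, Prop. 4 (97)–(98) pp.292–293, (73) p.289, (45)–(47) p.285, (80) p.290] -/
theorem exists_quadAnalytic_WOfRecordAt (hU₀ : SmallBelow (avOfRecord F N K) k U₀) :
    ∃ t₀ > 0, ∀ εC : ℝ, 0 < εC → εC ≤ t₀ → ∃ a₃ > 0, ∃ C₄ ≥ 0, a₃ ≤ εC ∧
      QuadAnalytic (WOfRecordAt F N K k Ω U₀ levB a hposb hQ εC Gp) C₄ a₃ := by
  haveI : CompleteSpace (NegSize (F.L : ℝ) ((F.P K).eta k) levB 0 (Matrix (Fin N) (Fin N) ℂ)) := FiniteDimensional.complete ℂ _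
  obtain ⟨b, C₂, c₄, t₀, -, -, -, ht₀, hP, hRC⟩ := exists_sectCRegime_ofRecord F N K k Ω U₀ levB a hposb hQ hU₀
  obtain ⟨CV, hCV, hqV⟩ := curV0AtRecord_quadBound_perLattice F N K k Ω U₀
  refine ⟨t₀, ht₀, fun εC hεC hεt => ?_⟩
  obtain ⟨R', hR', C₄, hC₄, hq, -⟩ := exists_quadAnalytic_W80 (rhoRec N) (tauRecCLM N) (unitsOfRecord F N U₀) hCV (by norm_num : (0 : ℝ) < 1 / 16) hqV
    (hRC εC εC hεC le_rfl hεt) hP hεC (JOfRecordAtBg F N K k Ω U₀) (DeltaPiCurOfRecord F N K k Ω U₀ Gp (QflatOfRecord F N k))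
  exact ⟨min R' εC, lt_min hR' hεC, C₄, hC₄, min_le_right _ _, quadAnalytic_of_radius_le hq (min_le_left _ _)⟩

end Prop4W

section Flat

variable (F : T4Family) (N : ℕ) [NeZero N] (K : ℕ) (k : ℕ) (Ω : ℕ → Set (Site (F.P K) 0))
  [Fact (0 < (F.L : ℝ))] [Fact (0 < (F.P K).eta k)] [Fact (0 < c0Rec F K k)] [Fact (∀ c, 0 < wBRec F K k c)]
  (levB : PBond (F.P K) k → ℕ) (a : ℝ)
  (hposb : ∀ x, x ≠ 0 → 0 < RCLike.re ⟪x, laplaceAOfRecord F N k (1 : GaugeField (F.P K) 0 (SU N))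
    (QOfRecord F N k (1 : GaugeField (F.P K) 0 (SU N))) (QflatOfRecord F N k) a x⟫_ℂ)
  (hQ : Function.Surjective (QOfRecord F N k (1 : GaugeField (F.P K) 0 (SU N))))
  (Gp : SiteL2K ℂ (F.P K).d (fun _ => (F.P K).sitesPerDir 0) (c0Rec F K k) (WRec N) →ₗ[ℂ]
    SiteL2K ℂ (F.P K).d (fun _ => (F.P K).sitesPerDir 0) (c0Rec F K k) (WRec N))

/-- ★★★ **(R2) AT THE FLAT RECORD SCHEME, PER LATTICE, IN THE SMALL, NO GUARD** (`U₀ = 1`, ✓`smallBelow_one`): the (R2) input of ✓`regimeTok_flat_ofRecord_small` ∕ of the flat (R-a) road.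
[cite: Balaban1985Variational, Prop. 4 (97)–(98) pp.292–293, p.302] -/
theorem exists_quadAnalytic_WOfRecordAt_one :
    ∃ t₀ > 0, ∀ εC : ℝ, 0 < εC → εC ≤ t₀ → ∃ a₃ > 0, ∃ C₄ ≥ 0, a₃ ≤ εC ∧
      QuadAnalytic (WOfRecordAt F N K k Ω (1 : GaugeField (F.P K) 0 (SU N)) levB a hposb hQ εC Gp) C₄ a₃ :=
  exists_quadAnalytic_WOfRecordAt F N K k Ω (1 : GaugeField (F.P K) 0 (SU N)) levB a hposb hQ Gp
    (Summit.QuantumFields.YangMills.BalabanUVNodes.N07ChartLineFactsS1.smallBelow_one F K k)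

end Flat

end Summit.QuantumFields.YangMills.Theorems.N07Prop4WOfRecordPerLattice

end
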